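import Summits.BirchSwinnertonDyer.BirchSwinnertonDyer.Theorems.EisensteinPrimesB11DescentCertificate
import Summits.BirchSwinnertonDyer.BirchSwinnertonDyer.Theorems.EisensteinPrimesB11L3Cert3450r1
import HarnessLib

/-!
# Row B11 per pair, PREPRINT-FREE descent road — display `3450r1 @ 3` (nonsplit-notGV window cell = k5-p3's L3 anchor):
# `BSD(3450r1, 3)` from Gross–Zagier–Kolyvagin alone + the two READS (cell `bsd-eis`, seat `bsd-eis-k5-p4` g0; door p536512;
# RULING L76 gate (G3); THEOREMS ONLY — nothing booked)

HONEST FRAMING (cell `bsd-eis`, run/shared/lean/pub/bsd-eis/; row B11 = X2c = `CellC`; crux 4 `BSDpOnCellC` stmt-BirchSwinnertonDyer-19034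
OPEN; no label or count moves; BSD proved for no curve unconditionally). Table row `3450r @3` of `pub/bsd-eis/k5-p4-g0/B11-DESC3R1-TABLE-v1.tsv`
(3ba341440843231c): VERDICT `CERT`; record `3450r1 = [1, 1, 1, -888, 10281]` (`N = 3450 = 2·3·5²·23`), kernel `x − 10`, `(s_φ̂, s_φ, m, EXCESS) =
(0, 1, 1, 0)` on `isogchi` ‖ `isogcft` IDENTICAL; class `3450r` = 4 curves, `#Ш_an = 1` on every member (Cremona `allbsd` = PARI leg).
**IN THE KERNEL (imported BY NAME from k5-p3's L3 display `Theorems/EisensteinPrimesB11L3Cert3450r1.lean`, not restated):** `classX2_3450r1`,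
`isElliptic_3450r1`, `isGloballyMinimal_3450r1`. **READ (hypotheses):** `hr : r_an = 1`, `hq`/`hv` : `#Ш_an = q`, `ord₃ q = 0`, `h : Ш[3] = 0`
(EXCESS `= 0`, two engines, kit j280759). **PUBLISHED fact BY NAME:** `hGZK` only. This is a SECOND, mechanism-disjoint road at the pair k5-p3's
`bsdp_3450r1_at_three_l3` reaches through Kato–Wuthrich + Stein–Wuthrich + four `3`-adic readings.
Refs: [Miller2011LMS] Def. 1.1; [SilvermanAEC2009] X.4.2; Cremona `ecdata` class 3450r.
-/

set_option autoImplicit false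
set_option linter.dupNamespace false

noncomputable section

open scoped Classical

open WeierstrassCurve Literature.NumberTheory.EllipticCurves
  Literature.NumberTheory.EllipticCurves.Rank1Residual
  Literature.NumberTheory.EllipticCurves.Rank1Residual.Typed
  Summit.BirchSwinnertonDyer.Rank1Residual
  Summit.BirchSwinnertonDyer.Rank1Residual.X2
  Summit.BirchSwinnertonDyer.BirchSwinnertonDyer.Theorems.B11L3Cert3450r1
  Summit.BirchSwinnertonDyer.BirchSwinnertonDyer.Theorems.B11DescentCertificate

namespace Summit.BirchSwinnertonDyer.BirchSwinnertonDyer.Theorems.B11Descent3450r1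

/-- **X2c INSTANCE, DESCENT ROAD — `BSD(3450r1, 3)`** from Gross–Zagier–Kolyvagin (`hGZK`) and the two READS on `3450r1` (`#Ш_an` a `3`-adic
unit; `Ш[3] = 0` by the two isogeny-descent engines), through `X2.cellC_bsdp_of_shaAn_unit_of_noPTorsion`; `CellC 3450r1 3 = ⟨hr, classX2_3450r1⟩`
with k5-p3's kernel-proved `ClassX2`. Nothing booked. [cite: Miller2011LMS, §1 and Def. 1.1] -/
theorem bsdp_3450r1_at_three_of_descent (hGZK : rank_eq_analyticRank_of_analyticRank_le_one)
    (W : WeierstrassCurve ℚ) [W.IsElliptic] [W.IsGloballyMinimal] (hW : W = ⟨1, 1, 1, (-888), 10281⟩)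
    (hr : W.analyticRank = 1) {q : ℚ} (hq : shaAn W = (q : ℂ)) (hv : padicValRat 3 q = 0)
    (h : ∀ x : W.sha, (3 : ℤ) • x = 0 → x = 0) : BSDp W 3 := by
  subst hW
  exact X2.cellC_bsdp_of_shaAn_unit_of_noPTorsion _ 3 hGZK ⟨hr, classX2_3450r1⟩ hq hv h

/-- **The same on the route's cell predicate**: `CellC 3450r1 3 → BSD(3450r1, 3)` modulo GZK and the two reads.
[cite: Miller2011LMS, §1 and Def. 1.1] -/
theorem targetC_3450r1_at_three_of_descent (hGZK : rank_eq_analyticRank_of_analyticRank_le_one)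
    (W : WeierstrassCurve ℚ) [W.IsElliptic] [W.IsGloballyMinimal] (hW : W = ⟨1, 1, 1, (-888), 10281⟩)
    {q : ℚ} (hq : shaAn W = (q : ℂ)) (hv : padicValRat 3 q = 0) (h : ∀ x : W.sha, (3 : ℤ) • x = 0 → x = 0) :
    CellC W 3 → BSDp W 3 :=
  fun hc ↦ bsdp_3450r1_at_three_of_descent hGZK W hW hc.1 hq hv h

/-- **DECISION at the pair** (the «either way» of the road): under the descent read `Ш(3450r1)[3] = 0`, `BSD(3450r1, 3)` holds IF AND ONLY IF
the `#Ш_an` read has `3`-adic valuation `0` (`X2.cellC_bsdp_iff_padicValRat_shaAn_eq_zero_of_noPTorsion`). [cite: Miller2011LMS, §1 and Def. 1.1] -/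
theorem bsdp_3450r1_at_three_iff_of_descent (hGZK : rank_eq_analyticRank_of_analyticRank_le_one)
    (W : WeierstrassCurve ℚ) [W.IsElliptic] [W.IsGloballyMinimal] (hW : W = ⟨1, 1, 1, (-888), 10281⟩)
    (hr : W.analyticRank = 1) (h : ∀ x : W.sha, (3 : ℤ) • x = 0 → x = 0) {q : ℚ} (hq : shaAn W = (q : ℂ)) :
    BSDp W 3 ↔ padicValRat 3 q = 0 := by
  subst hW
  exact X2.cellC_bsdp_iff_padicValRat_shaAn_eq_zero_of_noPTorsion _ 3 hGZK ⟨hr, classX2_3450r1⟩ h hq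

end Summit.BirchSwinnertonDyer.BirchSwinnertonDyer.Theorems.B11Descent3450r1

end
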